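import Summits.CriticalPhenomena.PercolationContinuityZ3.Theses.PercNearOneGluing
import Literature.Probability.Percolation.PercolationProofs
import Literature.Probability.Percolation.ConditionalPositiveAssociationProofs
import Literature.Probability.Percolation.TwoClusterConditionalAssociationProofs

/-! TTRL-lite variant V2071 of stmt-CriticalPhenomena-4576 -/

namespace Summit.CriticalPhenomena.PercolationContinuityZ3.Theorems

open MeasureTheory Literature.Probability.LatticeModels Literature.Probability.Percolation
open scoped Classical BigOperators

/-- **Good step, `|A| = 4`, `n ≤ 5` corner** (TTRL-lite variant V2071 of
stmt-CriticalPhenomena-4576).  With `A.card = 4`, `o ∉ A` and `n ≤ 5` the set `insert o A`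
already exhausts `Fin n`, so the live-neighbour hypothesis `∃ y ∉ A, y ≠ o, w s(o, y) ≠ 0`
cannot hold: a sixth vertex `y` would give `(insert y (insert o A)).card = 6 ≤ n ≤ 5`.
The goodness inequality therefore holds vacuously in this corner. -/
theorem cp4576_goodstep_var2071 :
    ∀ (n : ℕ) (w : Sym2 (Fin n) → unitInterval) (A : Finset (Fin n)) (o b : Fin n),
      A.card = 4 → n ≤ 5 → b ∈ A → o ∉ A →
      (∃ y : Fin n, y ∉ A ∧ y ≠ o ∧ (w s(o, y) : ℝ) ≠ 0) →
      (∀ w' : Sym2 (Fin n) → unitInterval,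
        (Finset.univ.filter (fun v : Fin n => ∃ u : Fin n, 0 < (w' s(u, v) : ℝ))).card <
          (Finset.univ.filter (fun v : Fin n => ∃ u : Fin n, 0 < (w s(u, v) : ℝ))).card →
        ∀ (A' : Finset (Fin n)) (o' b' : Fin n), b' ∈ A' → o' ∉ A' →
        ∀ (t : ℝ) (sel : Finset (Fin n) → Fin n), (∀ W, sel W ∈ A') →
        (∀ a ∈ A', 1 - t ≤ (prodBernoulli w').real (openConn a b')) →
        (prodBernoulli w').real ((⋃ a ∈ A', openConn o' a) ∩ (openConn o' b')ᶜ) +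
          ∑ W ∈ (Finset.univ : Finset (Finset (Fin n))).filter (fun W => o' ∈ W ∧ Disjoint W A'),
            (prodBernoulli w').real {ω : BondConfig (Fin n) | openCluster ω o' = (W : Set (Fin n))} *
              (prodBernoulli w').real (openConnIn ((W : Set (Fin n))ᶜ) (sel W) b')ᶜ ≤ t) →
      ∀ (t : ℝ) (sel : Finset (Fin n) → Fin n), (∀ W, sel W ∈ A) →
      (∀ a ∈ A, 1 - t ≤ (prodBernoulli w).real (openConn a b)) →
      (prodBernoulli w).real ((⋃ a ∈ A, openConn o a) ∩ (openConn o b)ᶜ) +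
        ∑ W ∈ (Finset.univ : Finset (Finset (Fin n))).filter (fun W => o ∈ W ∧ Disjoint W A),
          (prodBernoulli w).real {ω : BondConfig (Fin n) | openCluster ω o = (W : Set (Fin n))} *
            (prodBernoulli w).real (openConnIn ((W : Set (Fin n))ᶜ) (sel W) b)ᶜ ≤ t := by
  intro n w A o b hcard hn _ ho hy
  obtain ⟨y, hyA, hyo, -⟩ := hy
  exfalso
  have h1 : (insert o A).card = 5 := by
    rw [Finset.card_insert_of_notMem ho, hcard]
  have hy' : y ∉ insert o A := by
    simp only [Finset.mem_insert, not_or]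
    exact ⟨hyo, hyA⟩
  have h2 : (insert y (insert o A)).card = 6 := by
    rw [Finset.card_insert_of_notMem hy', h1]
  have h3 : (insert y (insert o A)).card ≤ n := by
    calc (insert y (insert o A)).card ≤ Fintype.card (Fin n) := Finset.card_le_univ _
      _ = n := Fintype.card_fin n
  omega

end Summit.CriticalPhenomena.PercolationContinuityZ3.Theorems
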